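import Mathlib
import HarnessLib
import Summits.HubbardSuperconductivity.HubbardSuperconductivity.Theorems.WeakCouplingBCSKlCertTPrimeCurvatureQuadratic
import Summits.HubbardSuperconductivity.HubbardSuperconductivity.Theorems.WeakCouplingBCSKlCertTPrimePocketChartDomination

/-!
# WeakCouplingBCS — KL certificate, `t′` rows: convex geometry of the Γ-pocket (bricks (G1), (G2) of programme «TPRIME-LINDHARD-HS»)

Two hypothesis-shaped inputs of the torus-sublevel estimate (N3)′ at the REFLECTED Γ-pocket of the t′ = −3/10 records
(pen (R475)(A); signatures typed by p4 g24, STATUS l.11253), for the one-band dispersion `ε_{t′} = squareDispersion 1 t′`: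

* §1 the `(π, π)`-parity of the five coordinate partials `dx, dy, dxx, dyy, dxy` of `…Theorems.KlTPrimeConvexity` and of the level-set
  curvature numerator: `N_{t′}(x + π, y + π) = −N_{−t′}(x, y)` (`kltp_curvNum_add_pi`).
* §2 **(G1)** Γ-side convexity by particle–hole reflection: for `0 < t′ < 1/2` and a level `μ < 4t′` with `4t′ − μ < 32|t′|(1 − 4t′²)`
  the curvature numerator is POSITIVE at every real solution of the level equation (`kltp_curvNum_pos_of_reflected_Mside`, from the M-side
  theorem ✓ `KlTPrimeConvexity.Mside_curvNum_neg` at `(−t′, −μ)`); the cell brick `kltp_curvNum_pos_p03` (`t′ = +3/10`, `μ′ ∈ [9/10, 1]`) with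
  a `Momentum` form and a polar-chart form (`0 < N` along `kltpPolar (3/10) μ′`).
* §3 **(G2)** level points are chart points mod `2π`: every real solution `(X, Y)` of the level equation on the Γ-window
  (`|t′| < 1/2`, `−4 − 4t′ < μ < 4t′`) has the cosines and sines of a point `kltpPolar t′ μ ψ` (`kltp_exists_angle_of_level`; reduction into
  `[−π, π)` by `toIcoMod` + ✓ `kltp_fermiCurve_subset_image_polar`).

Honest framing: elementary statements about the trigonometric polynomial `squareDispersion 1 t′` only; they are consumed as hypotheses by the
pair-energy nondegeneracy / torus-sublevel files of the p4 lineage.  Nothing here asserts the sublevel estimate, a Kohn–Luttinger margin,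
the window or superconductivity; RECORD ≠ DECIDED; a KL `O(U²)` channel statement is not ODLRO and nothing here proves superconductivity in
the Hubbard model.  Filed `--supports stmt-HubbardSuperconductivity-0158` (certificate half, R2d; risk-register item 1).

References: S. Raghu, S. A. Kivelson, D. J. Scalapino, Phys. Rev. B 81 (2010) 224505, §III (the `t–t′` band); S. Fratini, F. Guinea,
Phys. Rev. B 66 (2002) 125104, App. A (level-set curvature of `ε_{t′}`).
-/

noncomputable section

-- the tree's namespace `Summit.<Summit>.<Problem>.Theorems` repeats the summit name by design (D-0017)
set_option linter.dupNamespace false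

namespace Summit.HubbardSuperconductivity.HubbardSuperconductivity.Theorems

open Real Set Literature.MathematicalPhysics.QuantumLattice KlTPrimeConvexity

/-! ### §1 `(π, π)`-parity of the partials and of the curvature numerator -/

/-- `∂₀ε_{t′}(x + π, y + π) = −∂₀ε_{−t′}(x, y)`. [folklore] -/
theorem kltp_dx_add_pi (tp x y : ℝ) : dx tp (x + π) (y + π) = -dx (-tp) x y := by
  simp only [dx, sin_add_pi, cos_add_pi]; ring

/-- `∂₁ε_{t′}(x + π, y + π) = −∂₁ε_{−t′}(x, y)`. [folklore] -/
theorem kltp_dy_add_pi (tp x y : ℝ) : dy tp (x + π) (y + π) = -dy (-tp) x y := by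
  simp only [dy, sin_add_pi, cos_add_pi]; ring

/-- `∂₀₀ε_{t′}(x + π, y + π) = −∂₀₀ε_{−t′}(x, y)`. [folklore] -/
theorem kltp_dxx_add_pi (tp x y : ℝ) : dxx tp (x + π) (y + π) = -dxx (-tp) x y := by
  simp only [dxx, cos_add_pi]; ring

/-- `∂₁₁ε_{t′}(x + π, y + π) = −∂₁₁ε_{−t′}(x, y)`. [folklore] -/
theorem kltp_dyy_add_pi (tp x y : ℝ) : dyy tp (x + π) (y + π) = -dyy (-tp) x y := by
  simp only [dyy, cos_add_pi]; ring

/-- `∂₀₁ε_{t′}(x + π, y + π) = −∂₀₁ε_{−t′}(x, y)`. [folklore] -/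
theorem kltp_dxy_add_pi (tp x y : ℝ) : dxy tp (x + π) (y + π) = -dxy (-tp) x y := by
  simp only [dxy, sin_add_pi]; ring

/-- **Parity of the curvature numerator**: `N_{t′}(x + π, y + π) = −N_{−t′}(x, y)` (the numerator is cubic in the partials, each of which
flips sign under `k ↦ k + (π, π)`, `t′ ↦ −t′`). [folklore] -/
theorem kltp_curvNum_add_pi (tp x y : ℝ) : curvNum tp (x + π) (y + π) = -curvNum (-tp) x y := by
  simp only [curvNum, kltp_dx_add_pi, kltp_dy_add_pi, kltp_dxx_add_pi, kltp_dyy_add_pi, kltp_dxy_add_pi]; ring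

/-- The same parity read backwards: `N_{t′}(x, y) = −N_{−t′}(x − π, y − π)`. [folklore] -/
theorem kltp_curvNum_eq_neg_sub_pi (tp x y : ℝ) : curvNum tp x y = -curvNum (-tp) (x - π) (y - π) := by
  have h := kltp_curvNum_add_pi tp (x - π) (y - π)
  simp only [sub_add_cancel] at h
  exact h

/-- The reflected level equation: if `ε_{t′}(x, y) = μ` (hopping `t = 1`, written out) then `ε_{−t′}(x − π, y − π) = −μ`. [folklore] -/
theorem kltp_squareDispersion_mk_sub_pi {tp μ x y : ℝ}
    (h : -2 * 1 * (cos x + cos y) - 4 * tp * cos x * cos y = μ) :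
    squareDispersion 1 (-tp) (mk (x - π) (y - π)) = -μ := by
  simp only [squareDispersion, mk_apply_zero, mk_apply_one, cos_sub_pi]
  linarith

/-! ### §2 (G1) Γ-side convexity by particle–hole reflection -/

/-- **Γ-side convexity by reflection.** For `0 < t′ < 1/2` and a level `μ < 4t′` with `4t′ − μ < 32|t′|(1 − 4t′²)` (the reflected image
of the M-side window of `KlTPrimeConvexity.Mside_curvNum_neg`), the level-set curvature numerator of `ε_{t′}` is POSITIVE at every real
solution of the level equation `−2(cos x + cos y) − 4t′cos x cos y = μ` (no zone condition). [folklore] -/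
theorem kltp_curvNum_pos_of_reflected_Mside {tp μ : ℝ} (htp0 : 0 < tp) (htp1 : tp < 1 / 2) (hvh : μ < 4 * tp)
    (hdisc : 4 * tp - μ < 32 * |tp| * (1 - 4 * tp ^ 2)) {x y : ℝ}
    (h : -2 * 1 * (cos x + cos y) - 4 * tp * cos x * cos y = μ) : 0 < curvNum tp x y := by
  have hε := kltp_squareDispersion_mk_sub_pi h
  have hdisc' : -μ - 4 * (-tp) < 32 * |-tp| * (1 - 4 * (-tp) ^ 2) := by
    rw [abs_neg]; nlinarith [hdisc]
  have hneg := Mside_curvNum_neg (μ := -μ) (by linarith : -1 / 2 < -tp) (by linarith : -tp < 0) (by linarith) hdisc' hε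
  rw [mk_apply_zero, mk_apply_one] at hneg
  rw [kltp_curvNum_eq_neg_sub_pi]
  linarith

/-- **(G1) curvature sign on the Γ-pocket of `ε_{+3/10}`** (the reflected chart of the t′ = −3/10, μ ∈ [−1, −9/10] cell of the KL records):
for `μ′ ∈ [9/10, 1]` the curvature numerator `KlTPrimeConvexity.curvNum (3/10)` is POSITIVE at every real solution of
`−2(cos x + cos y) − (6/5)cos x cos y = μ′`.  Signature as typed by the consumer (p4 g24, STATUS l.11253). [folklore] -/
theorem kltp_curvNum_pos_p03 {μ' : ℝ} (hμ1 : 9 / 10 ≤ μ') (hμ2 : μ' ≤ 1) {x y : ℝ}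
    (h : -2 * 1 * (Real.cos x + Real.cos y) - 4 * (3 / 10) * Real.cos x * Real.cos y = μ') :
    0 < KlTPrimeConvexity.curvNum (3 / 10) x y := by
  refine kltp_curvNum_pos_of_reflected_Mside (by norm_num) (by norm_num) (by linarith) ?_ h
  rw [abs_of_pos (by norm_num : (0:ℝ) < 3 / 10)]
  norm_num
  linarith

/-- (G1), `Momentum` form: `0 < N_{3/10}(k₀, k₁)` whenever `squareDispersion 1 (3/10) k = μ′`, `μ′ ∈ [9/10, 1]`. [folklore] -/
theorem kltp_curvNum_pos_p03' {μ' : ℝ} (hμ1 : 9 / 10 ≤ μ') (hμ2 : μ' ≤ 1) {k : Momentum}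
    (hε : squareDispersion 1 (3 / 10) k = μ') : 0 < curvNum (3 / 10) (k 0) (k 1) :=
  kltp_curvNum_pos_p03 hμ1 hμ2 (by simpa [squareDispersion] using hε)

/-- (G1), chart form: along the polar chart `γ = kltpPolar (3/10) μ′` of the Γ-pocket (`μ′ ∈ [9/10, 1]` lies in the Γ-window
`−4 − 4·(3/10) < μ′ < 4·(3/10)`) the curvature numerator is positive at EVERY angle. [folklore] -/
theorem kltp_curvNum_pos_p03_polar {μ' : ℝ} (hμ1 : 9 / 10 ≤ μ') (hμ2 : μ' ≤ 1) (ψ : ℝ) :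
    0 < curvNum (3 / 10) (kltpPolar (3 / 10) μ' ψ 0) (kltpPolar (3 / 10) μ' ψ 1) := by
  have htp : |(3 / 10 : ℝ)| < 1 / 2 := by rw [abs_of_pos (by norm_num : (0:ℝ) < 3 / 10)]; norm_num
  exact kltp_curvNum_pos_p03' hμ1 hμ2 (kltpPolar_mem_fermiCurve htp (by linarith) (by linarith) ψ).2

/-! ### §3 (G2) Level points are chart points mod `2π` -/

/-- Reduction of a real number into the zone period `[−π, π)` keeping its cosine and sine. [folklore] -/
theorem kltp_exists_rep_Ico (X : ℝ) : ∃ x ∈ Ico (-π) π, cos x = cos X ∧ sin x = sin X := by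
  refine ⟨toIcoMod two_pi_pos (-π) X, ?_, ?_, ?_⟩
  · have h := toIcoMod_mem_Ico two_pi_pos (-π) X
    have e : -π + 2 * π = π := by ring
    rwa [e] at h
  · rw [← self_sub_toIcoDiv_zsmul, zsmul_eq_mul, cos_sub_int_mul_two_pi]
  · rw [← self_sub_toIcoDiv_zsmul, zsmul_eq_mul, sin_sub_int_mul_two_pi]

/-- **(G2) level points are chart points mod `2π`.** On the Γ-window (`|t′| < 1/2`, `−4 − 4t′ < μ < 4t′`) every real solution `(X, Y)` of
the level equation `−2(cos X + cos Y) − 4t′cos X cos Y = μ` has the cosines and sines of a chart point `kltpPolar t′ μ ψ`: reduce `X, Y`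
into `[−π, π)`, the reduced point lies on `fermiCurve (squareDispersion 1 t′) μ`, which the polar chart covers
(`kltp_fermiCurve_subset_image_polar`).  Signature as typed by the consumer (p4 g24, STATUS l.11253). [folklore] -/
theorem kltp_exists_angle_of_level {tp μ : ℝ} (htp : |tp| < 1 / 2) (hμ₁ : -4 - 4 * tp < μ) (hμ₂ : μ < 4 * tp) {X Y : ℝ}
    (h : -2 * 1 * (Real.cos X + Real.cos Y) - 4 * tp * Real.cos X * Real.cos Y = μ) :
    ∃ ψ : ℝ, Real.cos X = Real.cos (kltpPolar tp μ ψ 0) ∧ Real.sin X = Real.sin (kltpPolar tp μ ψ 0) ∧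
      Real.cos Y = Real.cos (kltpPolar tp μ ψ 1) ∧ Real.sin Y = Real.sin (kltpPolar tp μ ψ 1) := by
  obtain ⟨x, hx, hcx, hsx⟩ := kltp_exists_rep_Ico X
  obtain ⟨y, hy, hcy, hsy⟩ := kltp_exists_rep_Ico Y
  have hk : mk x y ∈ fermiCurve (squareDispersion 1 tp) μ := by
    refine ⟨mk_mem_brillouinZone hx hy, ?_⟩
    simp only [squareDispersion, mk_apply_zero, mk_apply_one, hcx, hcy]
    linarith
  obtain ⟨ψ, -, hψ⟩ := kltp_fermiCurve_subset_image_polar htp hμ₁ hμ₂ hk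
  refine ⟨ψ, ?_, ?_, ?_, ?_⟩
  · rw [hψ, mk_apply_zero, hcx]
  · rw [hψ, mk_apply_zero, hsx]
  · rw [hψ, mk_apply_one, hcy]
  · rw [hψ, mk_apply_one, hsy]

/-- (G2), `Momentum` form with the angle in `(−π, π]`: every point of `fermiCurve (squareDispersion 1 t′) μ` on the Γ-window IS a chart
point `kltpPolar t′ μ ψ`, `ψ ∈ (−π, π]` (restatement of `kltp_fermiCurve_subset_image_polar` as an existential). [folklore] -/
theorem kltp_exists_angle_of_mem_fermiCurve {tp μ : ℝ} (htp : |tp| < 1 / 2) (hμ₁ : -4 - 4 * tp < μ) (hμ₂ : μ < 4 * tp)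
    {k : Momentum} (hk : k ∈ fermiCurve (squareDispersion 1 tp) μ) :
    ∃ ψ ∈ Ioc (-π) π, kltpPolar tp μ ψ = k :=
  kltp_fermiCurve_subset_image_polar htp hμ₁ hμ₂ hk

end Summit.HubbardSuperconductivity.HubbardSuperconductivity.Theorems
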